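import Mathlib
import Literature.AlgebraicGeometry.Resolution.NearPointTauMonotone
import HarnessLib

/-!
# At an adapted `τ = 2` point the near point is the origin of the chart of the adapted parameter

Topic: `Literature/AlgebraicGeometry/Resolution`. [CoP1] Lemma 4.3 (3) in ADAPTED coordinates
("we choose `(y₁, y₂, y₃)` in such a way that `T_x = <Y₂, Y₃>` … the only point of `X′` which
may be near `x` is the point `x′ := (y₁′ = y₁, y₂′ = y₂/y₁, y₃′ = y₃/y₁)`"): if the regular system
of parameters `c` of `𝒪_{X,x}` is adapted to the chart index `j` in the sense that every form of the
directrix `T_x` kills `e_j` (i.e. `T_x ⊆ <Y_i : i ≠ j>`; at `τ = 2` this is `T_x = <Y_i : i ≠ j>`),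
then a near point `x′` over `x` lies in the `c_j`-chart and is its ORIGIN: there is a chart
presentation `𝒪_{X′,x′} = (B_j)_𝔴` w.r.t. `c` itself with `e_i ∈ 𝔴` for `i ≠ j`
(`IsBlowup.exists_origin_chart_of_adapted`; the unshifted form of
`IsBlowup.exists_origin_chart_of_isNear_point`). Consequently (`exists_adapted_transform`) the
elements `y_i′ := χ(e_i) ∈ 𝔪_{x′}` satisfy `π^*(c_i) = π^*(c_j) · y_i′`, and `(π^*(c_j), y′)` is a
regular system of parameters of the regular three-dimensional `𝒪_{X′,x′}` — the data consumed by
the weighted-order chain law (`WeightedOrderChainLaw.lean`).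

## Sources

* V. Cossart, O. Piltant, J. Algebra 320 (2008), Lemma 4.3 (3) and its proof. [CossartPiltant2008]
* H. Hironaka, *Desingularization of excellent surfaces* (Bowdoin 1967), LNM 1101, Thm. 2. [Hironaka1970]
-/

noncomputable section

open CategoryTheory CategoryTheory.Limits AlgebraicGeometry TopologicalSpace IsLocalRing MvPolynomial

namespace Literature.AlgebraicGeometry.Resolution

universe u

open Scheme.IdealSheafData

variable {X X' : Scheme.{u}} {π : X' ⟶ X}

set_option maxHeartbeats 400000 in
/-- **[CoP1] Lemma 4.3 (3) in adapted coordinates: the near point is the origin of the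
`c_j`-chart.** With `π` the blowing up along `Y`, `𝓘_{Y,x} = 𝔪_x = (c)` at `x = π x′`, `𝒪_{X,x}`
regular of dimension `3`, `τ(x) = 2`, `x′` near, and every form of `T_x` killing `e_j`: there is a
chart presentation `𝒪_{X′,x′} = (B_j)_𝔴` w.r.t. `c` with all `e_i ∈ 𝔴`, `i ≠ j`.
[cite: CossartPiltant2008, Lemma 4.3 (3)] [cite: Hironaka1970, Thm. 2] -/
theorem IsBlowup.exists_origin_chart_of_adapted [IsLocallyNoetherian X] [IsLocallyNoetherian X']
    {Y : Closeds X} (hπ : IsBlowup π (vanishingIdeal Y)) {J : X.IdealSheafData} {μ : ℕ}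
    {x' : X'} [IsRegularLocalRing (X.presheaf.stalk (π x'))] [IsRegularLocalRing (X'.presheaf.stalk x')]
    (hd : (maximalIdeal (X.presheaf.stalk (π x'))).spanFinrank = 3)
    {c : Fin 3 → X.presheaf.stalk (π x')} (hc : Ideal.span (Set.range c) = maximalIdeal _)
    (hcY : Ideal.span (Set.range c) = stalkIdeal (vanishingIdeal Y) (π x'))
    (hτ : stalkTau J (π x') μ = 2) (hnear : IsNear π (vanishingIdeal Y) J μ x') (j : Fin 3)
    (hadapt : ∀ ℓ ∈ directrix (ResidueField (X.presheaf.stalk (π x')))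
      (initialForms c (stalkIdeal J (π x')) μ :
        Set (MvPolynomial (Fin 3) (ResidueField (X.presheaf.stalk (π x'))))), ℓ (Pi.single j 1) = 0) :
    ∃ (𝔴 : PrimeSpectrum (chartRing c j)) (χ : chartRing c j →+* X'.presheaf.stalk x'),
      (∀ a, χ (chartBase c j a) = (π.stalkMap x').hom a) ∧
      @IsLocalization.AtPrime _ _ (X'.presheaf.stalk x') _ χ.toAlgebra 𝔴.asIdeal _ ∧
      𝔴.asIdeal.comap (chartBase c j) = maximalIdeal _ ∧
      ∀ i, i ≠ j → chartGen c j i ∈ 𝔴.asIdeal := by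
  classical
  haveI := isDomain_of_isRegularLocalRing (X'.presheaf.stalk x')
  -- a chart presentation w.r.t. `c` in SOME chart `j₀`; the coordinates `a` of the near point
  obtain ⟨j₀, 𝔴, χ, hχ, hloc, h𝔴⟩ := hπ.exists_reesChart_stalk x' c hcY
  have h𝔴' : (maximalIdeal _).map (chartBase c j₀) ≤ 𝔴.asIdeal := by
    rw [← h𝔴]
    exact Ideal.map_comap_le
  have hnearF : ∀ F : MvPolynomial (Fin 3) (X.presheaf.stalk (π x')), F.IsHomogeneous μ →
      MvPolynomial.eval c F ∈ stalkIdeal J (π x') →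
      (algebraMap (chartRing c j₀) (Localization.AtPrime 𝔴.asIdeal) :
          chartRing c j₀ →+* Localization.AtPrime 𝔴.asIdeal)
          (MvPolynomial.eval₂Hom (chartBase c j₀) (fun i => chartGen c j₀ i) F) ∈
        maximalIdeal (Localization.AtPrime 𝔴.asIdeal) ^ μ :=
    fun F hF hFJ => algebraMap_eval₂Hom_mem_pow_of_isNear hcY j₀ 𝔴 χ hχ hloc hnear hF hFJ
  have hτc : hironakaTauAt c (stalkIdeal J (π x')) μ = 2 := by
    rw [← stalkTau_eq J (π x') μ hd c hc]; exact hτ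
  obtain ⟨ρ, -, -, hρF, hcomap, a, ha, hq⟩ :=
    exists_map_eq_span_of_near_point hd c hc j₀ 𝔴.asIdeal h𝔴' hnearF hτc
  -- `j₀ = j`: otherwise `Y_j − a_j Y_{j₀} ∈ T_x` does not kill `e_j`
  have hj₀ : j₀ = j := by
    by_contra hne
    have h := hadapt _ (ha ⟨j, Ne.symm hne⟩)
    simp only [LinearMap.sub_apply, LinearMap.smul_apply, LinearMap.coe_proj, Function.eval,
      Pi.single_apply, smul_eq_mul] at h
    rw [if_neg hne] at h
    simp at h
  subst hj₀
  -- `a = 0`: `(Y_i − a_i Y_j)(e_j) = −a_i`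
  have ha0 : ∀ i, a i = 0 := by
    intro i
    have h := hadapt _ (ha i)
    simp only [LinearMap.sub_apply, LinearMap.smul_apply, LinearMap.coe_proj, Function.eval,
      Pi.single_apply, smul_eq_mul] at h
    rw [if_neg i.2] at h
    simpa using h
  -- hence `e_i ∈ 𝔴`
  refine ⟨𝔴, χ, hχ, hloc, h𝔴, fun i hi => ?_⟩
  rw [hcomap, Ideal.mem_comap, map_chartGen_of_chartResidueMap c j₀ hρF hi, hq]
  have : (MvPolynomial.X ⟨i, hi⟩ :
      MvPolynomial {i : Fin 3 // i ≠ j₀} (ResidueField (X.presheaf.stalk (π x')))) =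
      MvPolynomial.X ⟨i, hi⟩ - MvPolynomial.C (a ⟨i, hi⟩) := by rw [ha0, map_zero, sub_zero]
  rw [this]
  exact Ideal.subset_span ⟨⟨i, hi⟩, rfl⟩

set_option maxHeartbeats 400000 in
/-- **The adapted transform of the parameters at the near point.** In the situation of
`IsBlowup.exists_origin_chart_of_adapted`, with the chart presentation `χ : B_j → 𝒪_{X′,x′}` at
the origin `𝔴`: the family `c′ := originFamily c j 𝒪_{X′,x′}` (`c′_j = π^*c_j`, `c′_i = χ(e_i)`
for `i ≠ j`) is a regular system of parameters of the regular three-dimensional local ring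
`𝒪_{X′,x′}`, and `π^*(c_i) = c′_j · c′_i` for `i ≠ j` ([CoP1]: "`x′ := (y₁′ = y₁, y₂′ = y₂/y₁,
y₃′ = y₃/y₁)`"). [cite: CossartPiltant2008, Lemma 4.3 (3)] -/
theorem exists_adapted_transform [IsLocallyNoetherian X] [IsLocallyNoetherian X']
    {Y : Closeds X} (hπ : IsBlowup π (vanishingIdeal Y)) {J : X.IdealSheafData} {μ : ℕ}
    {x' : X'} [IsRegularLocalRing (X.presheaf.stalk (π x'))] [IsRegularLocalRing (X'.presheaf.stalk x')]
    (hd : (maximalIdeal (X.presheaf.stalk (π x'))).spanFinrank = 3)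
    {c : Fin 3 → X.presheaf.stalk (π x')} (hc : Ideal.span (Set.range c) = maximalIdeal _)
    (hcY : Ideal.span (Set.range c) = stalkIdeal (vanishingIdeal Y) (π x'))
    (hτ : stalkTau J (π x') μ = 2) (hnear : IsNear π (vanishingIdeal Y) J μ x') (j : Fin 3)
    (hadapt : ∀ ℓ ∈ directrix (ResidueField (X.presheaf.stalk (π x')))
      (initialForms c (stalkIdeal J (π x')) μ :
        Set (MvPolynomial (Fin 3) (ResidueField (X.presheaf.stalk (π x'))))), ℓ (Pi.single j 1) = 0) :
    ∃ (𝔴 : PrimeSpectrum (chartRing c j)) (χ : chartRing c j →+* X'.presheaf.stalk x')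
      (_ : @IsLocalization.AtPrime _ _ (X'.presheaf.stalk x') _ χ.toAlgebra 𝔴.asIdeal _),
      (∀ a, χ (chartBase c j a) = (π.stalkMap x').hom a) ∧
      𝔴.asIdeal.comap (chartBase c j) = maximalIdeal _ ∧
      (∀ i, i ≠ j → chartGen c j i ∈ 𝔴.asIdeal) ∧
      (maximalIdeal (X'.presheaf.stalk x')).spanFinrank = 3 ∧
      (letI := χ.toAlgebra
       Ideal.span (Set.range (originFamily c j (X'.presheaf.stalk x'))) = maximalIdeal _) ∧
      (letI := χ.toAlgebra
       originFamily c j (X'.presheaf.stalk x') j = (π.stalkMap x').hom (c j)) ∧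
      ∀ i, i ≠ j → (letI := χ.toAlgebra
        (π.stalkMap x').hom (c i) =
          (π.stalkMap x').hom (c j) * originFamily c j (X'.presheaf.stalk x') i) := by
  obtain ⟨𝔴, χ, hχ, hloc, h𝔴, he⟩ :=
    hπ.exists_origin_chart_of_adapted hd hc hcY hτ hnear j hadapt
  letI := χ.toAlgebra
  haveI := hloc
  obtain ⟨-, hd', hspan⟩ := isRegularLocalRing_and_span_originFamily hd c hc j 𝔴.asIdeal h𝔴 he
    (X'.presheaf.stalk x')
  refine ⟨𝔴, χ, hloc, hχ, h𝔴, he, hd', hspan, ?_, fun i hi => ?_⟩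
  · rw [originFamily_self]; exact hχ (c j)
  · rw [originFamily_of_ne c j _ hi]
    exact stalkMap_apply_eq_mul_chartGen j χ hχ i

end Literature.AlgebraicGeometry.Resolution

end
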